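/-
Copyright (c) 2026 the pub-hodgecm-mathlib formalisation cell (harness21).  Prover seat hodgecm-mathlib-K2E2-p12 (g5): Track B «K2-LIT», ENGINE E1,
h413 = stmt-HodgeConjecture-24833; W5₃ (L3): deal (57)(ii) + ruling (68) of K2E1-plan (g6) «(L3-bad)», part (D): HOLOMORPHY on `{1 < Re z}` at every place.
-/
import Summits.HodgeConjecture.HodgeConjecture.Theorems.K2E1IntertwiningLocalFactorBadPlaceSplitU3   -- ★ (this seat) parts (B)+(C): `integrable_localHeight_rpow_neg` (every place, σ > 1)
import Summits.HodgeConjecture.HodgeConjecture.Theorems.K2E1WhittakerTokenWindowU3                  -- ★ F1 (K2E1-p10): `differentiableOn_integral_cpow_neg_mul[_window]`, `differentiableOn_token_of_integrable`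
import HarnessLib

/-!
# K2·E1 — `K2E1IntertwiningLocalFactorHolomorphicU3` (deal (57)(ii) «(L3-bad)», part (D), ruling (68)): AT EVERY FINITE PLACE `v` OF `L⁺`, the local intertwining factor
# `z ↦ ∫ Q_v^{−z} dν_v³` (and its normalised ∕ twisted Whittaker versions) IS HOLOMORPHIC ON `{1 < Re z}` — no goodness, ramification or unit hypothesis

Track B ∕ K2-LIT, crux h413 = `stmt-HodgeConjecture-24833`, route of record `HCCMUnconditional`; cell `hodgecm-mathlib`, squad K2, ENGINE E1 (W5₃ (L3): K2E4-p14 (g7)'s FILE 2 cites integrability +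
holomorphy BY NAME and only assembles the restricted product ∕ ζ-quotient).  THEOREMS ONLY (no `def`, no instance, no notation, no `sorry`; default heartbeats); lane
`--supports stmt-HodgeConjecture-24833 --as helper` (count-neutral).  ASSEMBLY: ★ (C) `integrable_localHeight_rpow_neg` (every `v`, every real `σ > 1`) fed into ★ F1's dominated-
differentiation engines (`differentiableOn_integral_cpow_neg_mul_window`, majorant `Q_v^{−σ₁}` on each half-plane `{σ₁ < re}`, `1 < σ₁ < Re z₀`).
* `aestronglyMeasurable_localHeight_cpow_neg_mul_one` (★ B1 `continuous_localHeight`).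
* **`differentiableOn_integral_localHeight_cpow_neg (v)`**: `DifferentiableOn ℂ (z ↦ ∫ ((Q_v p : ℝ) : ℂ)^(−z) dν_v³) {1 < re}` — the bad-place (and good-place) local factor of the intertwining ∕
  constant-term Euler product, (L3)'s `c_v(z)`.
* **`differentiableOn_inv_smul_integral_localHeight_cpow_neg (v)`**: the same for the normalised factor `ν_v(𝒪_v³)⁻¹ • ∫ …`.
* **`differentiableOn_whittakerToken (v) (ξw)`**: ★ B1's TWISTED token `ν_v(𝒪_v³)⁻¹ • ∫ Q_v^{−z}·∏_{w'} ψ_{w'}(ξ_{w'} Ψ_v(p)_{w'})` is holomorphic on `{1 < re}` for EVERY local frequency vector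
  (★ F1 `differentiableOn_token_of_integrable` on every `{σ₁ < re}`, `σ₁ > 1`).
HONEST LABEL: HC_CM is proved only modulo the 7 printed citations (2 remaining named inputs: hLiu418 = `stmt-HodgeConjecture-24832`, h413 = `stmt-HodgeConjecture-24833`) until rung 0
closes; this file asserts no named fact and closes no socket; count-neutral; unconditional.

## References
* [Garrett2018] P. Garrett, *Modern Analysis of Automorphic Forms by Example* (2018): §2.8 (holomorphy of vector-valued integrals).
* [Langlands1971] R. P. Langlands, *Euler Products* (1971): §3.
* [TateThesis1967] J. Tate, *Fourier analysis in number fields and Hecke's zeta-functions* (1967): §3.3.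
-/

set_option autoImplicit false
set_option linter.dupNamespace false -- the mandated namespace repeats `HodgeConjecture.HodgeConjecture`

noncomputable section

open MeasureTheory NumberField IsDedekindDomain Filter
open scoped NNReal ENNReal
open Literature.NumberTheory.Automorphic Literature.NumberTheory.Automorphic.UnitaryGroup Literature.NumberTheory.GaloisRepresentations
open Literature.NumberTheory.GaloisRepresentations.IsNonarchimedeanLocalField
open Summit.HodgeConjecture.HodgeConjecture.Cruxes.H413.K2E1IntertwiningLocalFactorBadPlaceSplitU3 (integrable_localHeight_rpow_neg)
open Summit.HodgeConjecture.HodgeConjecture.Cruxes.H413.K2E1WhittakerTokenWindowU3 (differentiableOn_integral_cpow_neg_mul_window differentiableOn_token_of_integrable)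

namespace Summit.HodgeConjecture.HodgeConjecture.Cruxes.H413.K2E1IntertwiningLocalFactorHolomorphicU3

variable (L : Type) [Field L] [NumberField L] [IsCMField L] {δ : L} (hcδ : IsCMField.complexConj L δ = -δ) (hδ : δ ≠ 0)
  {d : ↥(maximalRealSubfield L)} (hd : δ * δ = algebraMap ↥(maximalRealSubfield L) L d) (v : HeightOneSpectrum (𝓞 ↥(maximalRealSubfield L)))
  [MeasurableSpace (v.adicCompletion ↥(maximalRealSubfield L))] [BorelSpace (v.adicCompletion ↥(maximalRealSubfield L))] (νv : Measure (v.adicCompletion ↥(maximalRealSubfield L))) [νv.IsAddHaarMeasure]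

omit [BorelSpace (v.adicCompletion ↥(maximalRealSubfield L))] in
/-- `p ↦ ((Q_v p : ℝ) : ℂ)^(−z) · 1` is a.e.-strongly measurable for every `z` (continuity; `Q_v ≥ 1 > 0` lies in the slit plane). [folklore] -/
theorem aestronglyMeasurable_localHeight_cpow_neg_mul_one [OpensMeasurableSpace (Fin 3 → v.adicCompletion ↥(maximalRealSubfield L))] (μ : Measure (Fin 3 → v.adicCompletion ↥(maximalRealSubfield L))) (z : ℂ) :
    AEStronglyMeasurable (fun p : Fin 3 → v.adicCompletion ↥(maximalRealSubfield L) =>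
      ((((∏ w' : PlacesOver L v, max 1 (max ((normAbs (w'.1.adicCompletion L) (quadraticLocalEquiv L v (IsCMField.complexConj L) hcδ hδ (p 0, p 1) w') : ℝ≥0) : ℝ)
          ((normAbs (w'.1.adicCompletion L) ((toLocalRing L v (p 2) * algebraMap L (LocalRing L v) δ -
            toLocalRing L v 2⁻¹ * (quadraticLocalEquiv L v (IsCMField.complexConj L) hcδ hδ (p 0, p 1) *
              conjLocal L (IsCMField.complexConj L) v (quadraticLocalEquiv L v (IsCMField.complexConj L) hcδ hδ (p 0, p 1)))) w') : ℝ≥0) : ℝ))) : ℝ) : ℂ) ^ (-z)) * (1 : ℂ)) μ := by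
  refine (Continuous.mul ?_ continuous_const).aestronglyMeasurable
  refine (Complex.continuous_ofReal.comp (K2E1WhittakerCoefficientEulerProductU3B.continuous_localHeight L hcδ hδ v)).cpow continuous_const fun p => ?_
  exact Complex.ofReal_mem_slitPlane.2 (lt_of_lt_of_le one_pos (Finset.one_le_prod fun w' _ => le_max_left _ _))

include hd in
/-- **THE LOCAL INTERTWINING FACTOR `z ↦ ∫ Q_v^{−z} dν_v³` IS HOLOMORPHIC ON `{1 < Re z}` AT EVERY FINITE PLACE** — (L3)'s `c_v(z)` numerator; ★ (C) integrability at every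
`σ > 1` + ★ F1's dominated differentiation. [cite: Garrett2018, §2.8] [cite: Langlands1971, §3] -/
theorem differentiableOn_integral_localHeight_cpow_neg :
    DifferentiableOn ℂ (fun z : ℂ => ∫ p : Fin 3 → v.adicCompletion ↥(maximalRealSubfield L),
      ((((∏ w' : PlacesOver L v, max 1 (max ((normAbs (w'.1.adicCompletion L) (quadraticLocalEquiv L v (IsCMField.complexConj L) hcδ hδ (p 0, p 1) w') : ℝ≥0) : ℝ)
          ((normAbs (w'.1.adicCompletion L) ((toLocalRing L v (p 2) * algebraMap L (LocalRing L v) δ -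
            toLocalRing L v 2⁻¹ * (quadraticLocalEquiv L v (IsCMField.complexConj L) hcδ hδ (p 0, p 1) *
              conjLocal L (IsCMField.complexConj L) v (quadraticLocalEquiv L v (IsCMField.complexConj L) hcδ hδ (p 0, p 1)))) w') : ℝ≥0) : ℝ))) : ℝ) : ℂ) ^ (-z)) ∂(Measure.pi fun _ : Fin 3 => νv)) {z : ℂ | 1 < z.re} := by
  haveI : SecondCountableTopology (v.adicCompletion ↥(maximalRealSubfield L)) := secondCountableTopology_localField _
  have h := differentiableOn_integral_cpow_neg_mul_window (Measure.pi fun _ : Fin 3 => νv) (χ := fun _ => (1 : ℂ))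
    (fun p => Finset.one_le_prod fun w' _ => le_max_left _ _) (fun _ => by rw [norm_one])
    (fun z => aestronglyMeasurable_localHeight_cpow_neg_mul_one L hcδ hδ v _ z)
    (fun σ hσ => integrable_localHeight_rpow_neg L hcδ hδ hd v νv hσ)
  refine h.congr fun z _ => ?_
  exact integral_congr_ae (Eventually.of_forall fun p => (mul_one _).symm)

include hd in
/-- **THE NORMALISED LOCAL FACTOR `z ↦ ν_v(𝒪_v³)⁻¹ • ∫ Q_v^{−z} dν_v³` IS HOLOMORPHIC ON `{1 < Re z}`** (every finite place). [cite: Garrett2018, §2.8] [cite: Langlands1971, §3] -/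
theorem differentiableOn_inv_smul_integral_localHeight_cpow_neg :
    DifferentiableOn ℂ (fun z : ℂ => ((Measure.pi fun _ : Fin 3 => νv) (integralBox ↥(maximalRealSubfield L) (Fin 3) v)).toReal⁻¹ • ∫ p : Fin 3 → v.adicCompletion ↥(maximalRealSubfield L),
      ((((∏ w' : PlacesOver L v, max 1 (max ((normAbs (w'.1.adicCompletion L) (quadraticLocalEquiv L v (IsCMField.complexConj L) hcδ hδ (p 0, p 1) w') : ℝ≥0) : ℝ)
          ((normAbs (w'.1.adicCompletion L) ((toLocalRing L v (p 2) * algebraMap L (LocalRing L v) δ -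
            toLocalRing L v 2⁻¹ * (quadraticLocalEquiv L v (IsCMField.complexConj L) hcδ hδ (p 0, p 1) *
              conjLocal L (IsCMField.complexConj L) v (quadraticLocalEquiv L v (IsCMField.complexConj L) hcδ hδ (p 0, p 1)))) w') : ℝ≥0) : ℝ))) : ℝ) : ℂ) ^ (-z)) ∂(Measure.pi fun _ : Fin 3 => νv)) {z : ℂ | 1 < z.re} :=
  (differentiableOn_integral_localHeight_cpow_neg L hcδ hδ hd v νv).const_smul
    (((Measure.pi fun _ : Fin 3 => νv) (integralBox ↥(maximalRealSubfield L) (Fin 3) v)).toReal⁻¹ : ℝ)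

include hd in
/-- **★ B1's TWISTED WHITTAKER TOKEN IS HOLOMORPHIC ON `{1 < Re z}` AT EVERY FINITE PLACE, FOR EVERY LOCAL FREQUENCY VECTOR `ξw`** (★ F1 `differentiableOn_token_of_integrable` on each
`{σ₁ < re}`, `1 < σ₁ = (1 + Re z₀)∕2`, with ★ (C)). [cite: Garrett2018, §2.8] [cite: TateThesis1967, §3.3] -/
theorem differentiableOn_whittakerToken (ξw : ∀ w' : PlacesOver L v, w'.1.adicCompletion L) :
    DifferentiableOn ℂ (fun z : ℂ => ((Measure.pi fun _ : Fin 3 => νv) (integralBox ↥(maximalRealSubfield L) (Fin 3) v)).toReal⁻¹ •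
      ∫ p : Fin 3 → v.adicCompletion ↥(maximalRealSubfield L),
        ((((∏ w' : PlacesOver L v, max 1 (max ((normAbs (w'.1.adicCompletion L) (quadraticLocalEquiv L v (IsCMField.complexConj L) hcδ hδ (p 0, p 1) w') : ℝ≥0) : ℝ)
          ((normAbs (w'.1.adicCompletion L) ((toLocalRing L v (p 2) * algebraMap L (LocalRing L v) δ -
            toLocalRing L v 2⁻¹ * (quadraticLocalEquiv L v (IsCMField.complexConj L) hcδ hδ (p 0, p 1) *
              conjLocal L (IsCMField.complexConj L) v (quadraticLocalEquiv L v (IsCMField.complexConj L) hcδ hδ (p 0, p 1)))) w') : ℝ≥0) : ℝ))) : ℝ) : ℂ) ^ (-z)) *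
          (∏ w' : PlacesOver L v, (adeleAddCharAt L w'.1 (ξw w' * quadraticLocalEquiv L v (IsCMField.complexConj L) hcδ hδ (p 0, p 1) w') : ℂ))
        ∂(Measure.pi fun _ : Fin 3 => νv)) {z : ℂ | 1 < z.re} := by
  intro z₀ hz₀
  have hz₀' : 1 < z₀.re := hz₀
  have hσ₁ : 1 < (1 + z₀.re) / 2 := by linarith
  have hmem : z₀ ∈ {z : ℂ | (1 + z₀.re) / 2 < z.re} := by show (1 + z₀.re) / 2 < z₀.re; linarith
  have hopen : IsOpen {z : ℂ | (1 + z₀.re) / 2 < z.re} := isOpen_lt continuous_const Complex.continuous_re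
  have h := differentiableOn_token_of_integrable L hcδ hδ v νv ξw (integrable_localHeight_rpow_neg L hcδ hδ hd v νv hσ₁)
  exact (h.differentiableAt (hopen.mem_nhds hmem)).differentiableWithinAt

end Summit.HodgeConjecture.HodgeConjecture.Cruxes.H413.K2E1IntertwiningLocalFactorHolomorphicU3

end
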